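import Summits.NavierStokesRegularity.NavierStokesRegularity.Theorems.LerayQuarterDissipationFiniteDissipationLiouvillePastDss
import Summits.NavierStokesRegularity.NavierStokesRegularity.Theorems.HubbleDynamoNoSelfExcitedDynamoStubFarFieldTransfer
import Literature.Analysis.FluidPDE.AncientAxisymmetricTypeILiouville
import HarnessLib

/-!
# `FiniteDissipationLiouville`, line `birth`: the blow-down leaf and the axisymmetric corner of the
# DSS wall on the finite-dissipation stratum

Crux `Summit.NavierStokesRegularity.NavierStokesRegularity.Theses.LerayQuarterDissipation.FiniteDissipationLiouville`
(item stmt-NavierStokesRegularity-22144), route LerayQuarterDissipation, line `birth`, lead prover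
ns-lqd-lead g2. NS regularity is NOT proved by anything here; no summit is.

The registered open stub of the line is the catalogued wall `∀ c > 1, TypeIDSSLiouville c`
(Bradshaw–Tsai 2017 OP 5.1). Its `L³` leaf (`…LThreeCorner.lean`, p588326) says: a past-DSS member
with ONE slice in `L³` vanishes. This file records the same boundary in the language of
Albritton–Barker 2019 Thm 4.1 (`ε = 0`; tree THEOREM `AlbrittonBarker2019_liouville_weakL3_backward_holds`,
used through `…NoSelfExcitedDynamo.Registered.farField_liouville_physical`): the only freedom left
to a nontrivial Type-I `λ`-DSS member of the stratum is a NONZERO BLOW-DOWN (homogeneous final datum).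

* `eq_zero_of_pastDss_of_vanishes_before` — past-DSS (`c > 1`) fields vanishing on `t ≤ t₀ < 0`
  vanish on the whole past (forward propagation along the scaling orbit).
* `eq_zero_of_pastDss_of_blowdown_tendsto_zero` — **the blow-down leaf of the wall, every `λ > 1`**:
  a member of the finite-dissipation Type-I ancient mild stratum which is `c`-DSS on the past and
  has ONE slice `w t₀`, `t₀ < 0`, whose Navier–Stokes blow-downs `λ w(t₀)(λ·)` tend to `0` in `𝒟'`
  as `λ → +∞`, vanishes on `t < 0`. (Envelope bridge `exists_hasTypeIDecay_of_dss`, classical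
  continuation `exists_isClassicalNSSolutionOn_Iio_of_dss`, time shift, `farField_liouville_physical`,
  forward propagation.)
* `eq_zero_of_pastDss_of_isAxisymmetric` — **the axisymmetric corner of the wall on the stratum**:
  a past-DSS member whose slices are axisymmetric vanishes (envelope bridge + KNSS 2009 Thm 5.3 in
  the tree form `IsAncientMildSolution.ae_eq_zero_of_isAxisymmetric_of_hasTypeIDecay`).
-/

noncomputable section

open MeasureTheory Set Function Filter
open scoped Topology ENNReal NNReal RealInnerProductSpace

namespace Summit.NavierStokesRegularity.NavierStokesRegularity.Theorems.FiniteDissipationLiouville.Birth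

open Literature.Analysis.FluidPDE
open Summit.NavierStokesRegularity.NavierStokesRegularity.Theorems.NoSelfExcitedDynamo.Registered
  (farField_liouville_physical hardness_hasTypeIDecay_translate hardness_isBoundedOn_translate)

-- the problem-side namespace duplicates `NavierStokesRegularity` by design (summit = problem)
set_option linter.dupNamespace false

/-- **Forward propagation of vanishing along a past-DSS orbit.** If `c • w (c²t) (c•x) = w t x`
for all `t < 0` (`1 < c`) and `w(s, ·) = 0` for all `s ≤ t₀` (some `t₀ : ℝ`), then `w(s, ·) = 0`
for every `s < 0`: `w(s, x) = c^k • w((c²)^k s, c^k x)` and `(c²)^k s ≤ t₀` for `k` large. -/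
theorem eq_zero_of_pastDss_of_vanishes_before {c : ℝ} (hc : 1 < c)
    {w : ℝ → EuclideanSpace ℝ (Fin 3) → EuclideanSpace ℝ (Fin 3)}
    (hpast : ∀ t : ℝ, t < 0 → ∀ x, c • w (c ^ 2 * t) (c • x) = w t x) {t₀ : ℝ}
    (hzero : ∀ s ≤ t₀, ∀ x, w s x = 0) : ∀ s < 0, ∀ x, w s x = 0 := by
  have hc2 : 1 < c ^ 2 := by nlinarith
  -- by induction on the number of orbit steps needed to pass below `t₀`
  have key : ∀ k : ℕ, ∀ s : ℝ, s < 0 → (c ^ 2) ^ k * s ≤ t₀ → ∀ x, w s x = 0 := by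
    intro k
    induction k with
    | zero =>
      intro s _ hs x
      rw [pow_zero, one_mul] at hs
      exact hzero s hs x
    | succ k ih =>
      intro s hs hk x
      have hcs : c ^ 2 * s < 0 := mul_neg_of_pos_of_neg (by positivity) hs
      have hk' : (c ^ 2) ^ k * (c ^ 2 * s) ≤ t₀ := by
        rw [← mul_assoc, ← pow_succ]
        exact hk
      rw [← hpast s hs x, ih (c ^ 2 * s) hcs hk' (c • x), smul_zero]
  intro s hs x
  -- `(c²)^k s → -∞`, so some `k` works
  have hτ : Tendsto (fun k : ℕ => (c ^ 2) ^ k * s) atTop atBot :=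
    (tendsto_pow_atTop_atTop_of_one_lt hc2).atTop_mul_const_of_neg hs
  obtain ⟨k, hk⟩ := (hτ.eventually (eventually_le_atBot t₀)).exists
  exact key k s hs hk x

/-- **The blow-down leaf of the Type-I DSS wall on the stratum, every `λ > 1`** (Albritton–Barker
2019 Thm 4.1 with `ε = 0`). A member of the finite-dissipation Type-I ancient mild stratum
(`IsTypeIAncientMild C w`, `∫ ‖∇w(s)‖² ≤ K/√(−s)`) which is `c`-DSS on the past (`1 < c`) and has
one slice `w t₀` (`t₀ < 0`) with trivial blow-down — `∫ ⟪λ w(t₀)(λx), φ(x)⟫ dx → 0` as `λ → +∞`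
for every smooth compactly supported `φ` — vanishes identically on `t < 0`. Proof: extend to a
time-global DSS field with the same past; it has a space-time Type-I envelope (Chae–Wolf bridge
`exists_hasTypeIDecay_of_dss`) and a classical continuation to `(−∞,0)`; shift time by
`δ = −t₀/2` to make it bounded; `farField_liouville_physical` (uniform weak-`L³` from the
envelope, heat-kernel bound of the final slice from `|w(t₀,z)| ≤ C₀/|z|`, AB Thm 4.1) makes it
vanish for `t ≤ t₀`; forward propagation along the orbit finishes. Contrapositive: a nontrivial
Type-I `λ`-DSS member of the stratum has a NONZERO blow-down at EVERY slice — the homogeneous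
final datum is the whole residue of Bradshaw–Tsai OP 5.1 here. -/
theorem eq_zero_of_pastDss_of_blowdown_tendsto_zero {C K c : ℝ}
    {w : ℝ → EuclideanSpace ℝ (Fin 3) → EuclideanSpace ℝ (Fin 3)} (hw : IsTypeIAncientMild C w)
    (hD : ∀ s : ℝ, s < 0 → ∫⁻ x, ‖fderiv ℝ (w s) x‖ₑ ^ 2 ≤ ENNReal.ofReal (K / Real.sqrt (-s)))
    (hc : 1 < c) (hpast : ∀ t : ℝ, t < 0 → ∀ x, c • w (c ^ 2 * t) (c • x) = w t x)
    {t₀ : ℝ} (ht₀ : t₀ < 0)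
    (hzoom : ∀ φ : EuclideanSpace ℝ (Fin 3) → EuclideanSpace ℝ (Fin 3),
      Literature.Analysis.FunctionSpaces.IsTestFunctionOn
          (⊤ : TopologicalSpace.Opens (EuclideanSpace ℝ (Fin 3))) φ →
        Tendsto (fun lam : ℝ => ∫ x, ⟪lam • w t₀ (lam • x), φ x⟫) atTop (𝓝 0)) :
    ∀ t < 0, ∀ x, w t x = 0 := by
  -- time-global DSS extension with the same past
  obtain ⟨w', hdss', hp⟩ := exists_dss_extension_of_pastDSS (one_pos.trans hc) hpast
  have hw' : IsTypeIAncientMild C w' := CorkscrewProfile.Birth.isTypeIAncientMild_congr_neg hw hp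
  have hD' : ∀ s : ℝ, s < 0 →
      ∫⁻ x, ‖fderiv ℝ (w' s) x‖ₑ ^ 2 ≤ ENNReal.ofReal (K / Real.sqrt (-s)) :=
    fun s hs => by rw [hp s hs]; exact hD s hs
  -- envelope and classical continuation
  obtain ⟨C₀, henv⟩ := exists_hasTypeIDecay_of_dss hw' hD' hc hdss'
  obtain ⟨P, hP⟩ := exists_isClassicalNSSolutionOn_Iio_of_dss hw' hc hdss'
  -- shift by `δ = -t₀/2 > 0`
  set δ : ℝ := -t₀ / 2 with hδ
  have hδ0 : 0 < δ := by rw [hδ]; linarith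
  set v : ℝ → EuclideanSpace ℝ (Fin 3) → EuclideanSpace ℝ (Fin 3) := fun t => w' (t + -δ) with hv
  have hcl : IsClassicalNSSolutionOn (Iio 0) 1 0 v (fun t => P (t + -δ)) := by
    have hsub : Iio (0 : ℝ) ⊆ (· + -δ) ⁻¹' Iio 0 := fun t ht => by
      simp only [mem_preimage, mem_Iio] at ht ⊢
      linarith
    exact (hP.comp_add_right (-δ)).mono hsub (uniqueDiffOn_Iio 0)
  have hdec : HasTypeIDecay C₀ v := hardness_hasTypeIDecay_translate henv hδ0.le
  have hbdd : IsBoundedOn (Iio 0) v := hardness_isBoundedOn_translate henv hδ0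
  have ht₀' : t₀ + δ < 0 := by rw [hδ]; linarith
  have hslice : v (t₀ + δ) = w t₀ := by
    simp only [hv, add_neg_cancel_right]
    exact hp t₀ ht₀
  have hzoom' : ∀ φ : EuclideanSpace ℝ (Fin 3) → EuclideanSpace ℝ (Fin 3),
      Literature.Analysis.FunctionSpaces.IsTestFunctionOn
          (⊤ : TopologicalSpace.Opens (EuclideanSpace ℝ (Fin 3))) φ →
        Tendsto (fun lam : ℝ => ∫ x, ⟪lam • v (t₀ + δ) (lam • x), φ x⟫) atTop (𝓝 0) := by
    intro φ hφ
    rw [hslice]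
    exact hzoom φ hφ
  have hvz := farField_liouville_physical hcl hdec hbdd ht₀' hzoom'
  -- `w` vanishes for `t ≤ t₀`, then everywhere on the past
  have hwz : ∀ s ≤ t₀, ∀ x, w s x = 0 := by
    intro s hs x
    have h1 := hvz (s + δ) (by linarith) x
    simp only [hv, add_neg_cancel_right] at h1
    rw [← congrFun (hp s (by linarith)) x]
    exact h1
  exact eq_zero_of_pastDss_of_vanishes_before hc hpast hwz

/-- The blow-down leaf in the regularity form of the line's DSS stub. -/
theorem notSingular_of_pastDss_of_blowdown_tendsto_zero {C K c : ℝ}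
    {w : ℝ → EuclideanSpace ℝ (Fin 3) → EuclideanSpace ℝ (Fin 3)} (hw : IsTypeIAncientMild C w)
    (hD : ∀ s : ℝ, s < 0 → ∫⁻ x, ‖fderiv ℝ (w s) x‖ₑ ^ 2 ≤ ENNReal.ofReal (K / Real.sqrt (-s)))
    (hc : 1 < c) (hpast : ∀ t : ℝ, t < 0 → ∀ x, c • w (c ^ 2 * t) (c • x) = w t x)
    {t₀ : ℝ} (ht₀ : t₀ < 0)
    (hzoom : ∀ φ : EuclideanSpace ℝ (Fin 3) → EuclideanSpace ℝ (Fin 3),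
      Literature.Analysis.FunctionSpaces.IsTestFunctionOn
          (⊤ : TopologicalSpace.Opens (EuclideanSpace ℝ (Fin 3))) φ →
        Tendsto (fun lam : ℝ => ∫ x, ⟪lam • w t₀ (lam • x), φ x⟫) atTop (𝓝 0)) :
    ¬ (∀ r > 0, ∀ M : ℝ, ∃ t ∈ Set.Ioo (-(r ^ 2)) (0 : ℝ),
        ∃ x ∈ Metric.ball (0 : EuclideanSpace ℝ (Fin 3)) r, M < ‖w t x‖) := by
  intro hsing
  obtain ⟨t, ht, x, -, hMx⟩ := hsing 1 one_pos 0
  rw [eq_zero_of_pastDss_of_blowdown_tendsto_zero hw hD hc hpast ht₀ hzoom t ht.2 x, norm_zero]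
    at hMx
  exact lt_irrefl _ hMx

/-- **The axisymmetric corner of the DSS wall on the stratum** (KNSS 2009 Thm 5.3, tree form
`IsAncientMildSolution.ae_eq_zero_of_isAxisymmetric_of_hasTypeIDecay`). A member of the
finite-dissipation Type-I ancient mild stratum which is `c`-DSS on the past (`1 < c`) and whose
slices `w t`, `t < 0`, are axisymmetric vanishes identically on `t < 0`: the DSS extension has a
space-time Type-I envelope (bridge `exists_hasTypeIDecay_of_dss`), so KNSS's theorem makes every
slice vanish a.e., hence everywhere by continuity. -/
theorem eq_zero_of_pastDss_of_isAxisymmetric {C K c : ℝ}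
    {w : ℝ → EuclideanSpace ℝ (Fin 3) → EuclideanSpace ℝ (Fin 3)} (hw : IsTypeIAncientMild C w)
    (hD : ∀ s : ℝ, s < 0 → ∫⁻ x, ‖fderiv ℝ (w s) x‖ₑ ^ 2 ≤ ENNReal.ofReal (K / Real.sqrt (-s)))
    (hc : 1 < c) (hpast : ∀ t : ℝ, t < 0 → ∀ x, c • w (c ^ 2 * t) (c • x) = w t x)
    (haxi : ∀ t < 0, IsAxisymmetric (w t)) : ∀ t < 0, ∀ x, w t x = 0 := by
  obtain ⟨w', hdss', hp⟩ := exists_dss_extension_of_pastDSS (one_pos.trans hc) hpast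
  have hw' : IsTypeIAncientMild C w' := CorkscrewProfile.Birth.isTypeIAncientMild_congr_neg hw hp
  have hD' : ∀ s : ℝ, s < 0 →
      ∫⁻ x, ‖fderiv ℝ (w' s) x‖ₑ ^ 2 ≤ ENNReal.ofReal (K / Real.sqrt (-s)) :=
    fun s hs => by rw [hp s hs]; exact hD s hs
  obtain ⟨C₀, henv⟩ := exists_hasTypeIDecay_of_dss hw' hD' hc hdss'
  have hae := hw'.isAncientMildSolution.ae_eq_zero_of_isAxisymmetric_of_hasTypeIDecay
    (fun t ht => hw'.aestronglyMeasurable_slice ht) (fun t ht => by rw [hp t ht]; exact haxi t ht)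
    henv
  intro t ht x
  have h0 : w' t = 0 :=
    ((hw'.continuous_slice ht).ae_eq_iff_eq volume continuous_const).1 (hae t ht)
  rw [← congrFun (hp t ht) x, h0, Pi.zero_apply]

end Summit.NavierStokesRegularity.NavierStokesRegularity.Theorems.FiniteDissipationLiouville.Birth

end
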